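import Literature.NumberTheory.LFunctions.RudnickSarnakNMeanValue
import Literature.NumberTheory.LFunctions.RudnickSarnakNExplicit
import Mathlib.NumberTheory.LSeries.Convolution
import Mathlib.NumberTheory.Chebyshev
import HarnessLib

/-!
# Rudnick–Sarnak `n`-level correlations for `ζ`, V: the prime coefficients of the slots

Sibling file of `Literature/NumberTheory/LFunctions/RudnickSarnak.lean` (toward
`Literature.NumberTheory.LFunctions.rudnick_sarnak_unrestricted` at every level). Arithmetic of
the Dirichlet polynomials `𝒜(a, t)` (`RudnickSarnakN.primePoly`) produced by the explicit
formula in one slot, and of their products over several slots (Rudnick–Sarnak 1996, §3,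
(3.14)–(3.15) and Lemma 3.5 / (3.37): the coefficients `a_r(m) = Σ_{n_1 ⋯ n_r = m} Π Λ(n_i)` of the
`r`-fold products).

* `RudnickSarnakN.coefR a n = Λ(n) n^{−1/2} g₀(log n − a) ≥ 0`, supported in
  `e^{a−1/4} < n < e^{a+1/4}`, `≤ ∫φ · Λ(n)/√n`; as an arithmetic function `coefAF a`.
* `primePoly a t = Σ_n coefR a n · n^{−it}` for `a ≥ 0` and `= conj(Σ_n coefR (−a) n · n^{−it})`
  for `a ≤ 0` (`RudnickSarnakN.primePoly_eq_dirPoly`, `RudnickSarnakN.primePoly_eq_conj_dirPoly`).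
* Chebyshev (`Chebyshev.psi_le_const_mul_self`): `Σ_n coefR a n ≤ C e^{a/2}`
  (`RudnickSarnakN.sum_coefR_le`).
* `a_r ≤ log^r`: `(Λ^{*r})(m) ≤ (log m)^r` (`RudnickSarnakN.vonMangoldt_pow_le`; RS use the cruder
  Lemma 3.5).
* Products over a finite set `S` of slots (`RudnickSarnakN.coefProd S a = Π_{j∈S} coefAF (a j)`,
  Dirichlet product): pointwise bound `≤ (∫φ)^{|S|} (Λ^{*|S|})(m)/√m`, support in
  `e^{Σ a_j − |S|/4} < m ≤ Π_j ⌊e^{a_j+1/4}⌋`, `ℓ¹`-bound `Π_j C e^{a_j/2}`, square sums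
  `Σ_m (coefProd m)² ≤ (C' log N)^{|S|}` and the multiplicativity of the Dirichlet polynomials
  `dirPoly (coefProd S a) = Π_{j∈S} dirPoly (coefAF (a j))` (via `LSeries_convolution'`).

## References

* Z. Rudnick, P. Sarnak, *Zeros of principal `L`-functions and random matrix theory*, Duke Math.
  J. 81 (1996), 269–322, §3, (3.14)–(3.15), Lemma 3.5, (3.37).
-/

noncomputable section

open Complex Filter Set MeasureTheory
open ArithmeticFunction (vonMangoldt_nonneg vonMangoldt_apply_one vonMangoldt_sum mul_apply one_apply)
open scoped Real Topology ComplexConjugate ArithmeticFunction.vonMangoldt LSeries.notation Chebyshev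

namespace Literature.NumberTheory.LFunctions

namespace RudnickSarnakN

/-! ## The coefficients of one slot -/

/-- The prime coefficient of one slot: `c_a(n) := Λ(n) n^{−1/2} g₀(log n − a)` (real, `≥ 0`).
(Rudnick–Sarnak 1996, (3.14): `c(n) = Λ(n) a(n)`, weight `n^{−1/2} g(T(Lξ + log n))`.)
[cite: RudnickSarnak1996, (3.14)] -/
def coefR (a : ℝ) (n : ℕ) : ℝ :=
  Λ n / Real.sqrt n * (g0 (Real.log n - a)).re

/-- `c_a(n) ≥ 0`. [folklore] -/
theorem coefR_nonneg (a : ℝ) (n : ℕ) : 0 ≤ coefR a n :=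
  mul_nonneg (div_nonneg vonMangoldt_nonneg (Real.sqrt_nonneg _)) (g0_re_nonneg _)

/-- `c_a(0) = 0`. [folklore] -/
@[simp] theorem coefR_zero (a : ℝ) : coefR a 0 = 0 := by
  simp [coefR]

/-- `c_a(1) = 0` (`Λ(1) = 0`). [folklore] -/
@[simp] theorem coefR_one (a : ℝ) : coefR a 1 = 0 := by
  simp [coefR]

/-- `c_a(n) ≤ ∫φ · Λ(n)/√n`. [folklore] -/
theorem coefR_le (a : ℝ) (n : ℕ) : coefR a n ≤ bumpMass * (Λ n / Real.sqrt n) := by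
  unfold coefR
  rw [mul_comm bumpMass]
  exact mul_le_mul_of_nonneg_left (g0_re_le _) (div_nonneg vonMangoldt_nonneg (Real.sqrt_nonneg _))

/-- Support, upper end: `c_a(n) = 0` if `e^{a + 1/4} ≤ n`. [folklore] -/
theorem coefR_eq_zero_of_exp_le {a : ℝ} {n : ℕ} (h : Real.exp (a + 1 / 4) ≤ n) : coefR a n = 0 := by
  have hn : (0 : ℝ) < n := (Real.exp_pos _).trans_le h
  have hlog : a + 1 / 4 ≤ Real.log n := by rwa [Real.le_log_iff_exp_le hn]
  have : g0 (Real.log n - a) = 0 := g0_eq_zero (by rw [abs_of_nonneg (by linarith)]; linarith)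
  simp [coefR, this]

/-- Support, lower end: `c_a(n) = 0` if `0 < n ≤ e^{a − 1/4}`. [folklore] -/
theorem coefR_eq_zero_of_le_exp {a : ℝ} {n : ℕ} (hn : n ≠ 0) (h : (n : ℝ) ≤ Real.exp (a - 1 / 4)) :
    coefR a n = 0 := by
  have hn' : (0 : ℝ) < n := by exact_mod_cast Nat.pos_of_ne_zero hn
  have hlog : Real.log n ≤ a - 1 / 4 := by rwa [Real.log_le_iff_le_exp hn']
  have : g0 (Real.log n - a) = 0 := g0_eq_zero (by rw [abs_of_nonpos (by linarith)]; linarith)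
  simp [coefR, this]

/-- If `c_a(n) ≠ 0` then `e^{a − 1/4} < n`. [folklore] -/
theorem exp_lt_of_coefR_ne_zero {a : ℝ} {n : ℕ} (h : coefR a n ≠ 0) : Real.exp (a - 1 / 4) < n := by
  by_contra hle
  push Not at hle
  have hn : n ≠ 0 := by rintro rfl; simp at h
  exact h (coefR_eq_zero_of_le_exp hn hle)

/-- If `c_a(n) ≠ 0` then `n < e^{a + 1/4}`. [folklore] -/
theorem lt_exp_of_coefR_ne_zero {a : ℝ} {n : ℕ} (h : coefR a n ≠ 0) : (n : ℝ) < Real.exp (a + 1 / 4) := by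
  by_contra hle
  push Not at hle
  exact h (coefR_eq_zero_of_exp_le hle)

/-- The support bound `N_a = ⌊e^{a + 1/4}⌋`. [folklore] -/
def suppBound (a : ℝ) : ℕ := ⌊Real.exp (a + 1 / 4)⌋₊

/-- `N_a ≤ e^{a + 1/4}`. [folklore] -/
theorem suppBound_le (a : ℝ) : (suppBound a : ℝ) ≤ Real.exp (a + 1 / 4) :=
  Nat.floor_le (Real.exp_pos _).le

/-- `c_a(n) = 0` for `n > N_a`. [folklore] -/
theorem coefR_eq_zero_of_suppBound_lt {a : ℝ} {n : ℕ} (h : suppBound a < n) : coefR a n = 0 := by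
  refine coefR_eq_zero_of_exp_le ?_
  have := (Nat.floor_lt (Real.exp_pos _).le).1 h
  exact this.le

/-- The coefficients of one slot as an arithmetic function. [folklore] -/
def coefAF (a : ℝ) : ArithmeticFunction ℝ :=
  ⟨coefR a, coefR_zero a⟩

/-- Unfolding `coefAF`. [folklore] -/
@[simp] theorem coefAF_apply (a : ℝ) (n : ℕ) : coefAF a n = coefR a n := rfl

/-- The complex form of the coefficient: `Λ(n)/√n · g₀(log n − a) = ↑(c_a(n))`. [folklore] -/
theorem ofReal_coefR (a : ℝ) (n : ℕ) :
    ((coefR a n : ℝ) : ℂ) = ((Λ n : ℝ) : ℂ) / (Real.sqrt n : ℂ) * g0 (Real.log n - a) := by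
  unfold coefR
  push_cast
  rw [← g0_eq_re]

/-! ## `primePoly` as a Dirichlet polynomial -/

/-- `log 2 > 1/4`. [folklore] -/
theorem quarter_lt_log_two : (1 / 4 : ℝ) < Real.log 2 := by
  have := Real.log_two_gt_d9; linarith

/-- For `n ≥ 2` and `a ≥ 0`: `g₀(log n + a) = 0`. [folklore] -/
theorem g0_log_add_eq_zero {a : ℝ} (ha : 0 ≤ a) {n : ℕ} (hn : 2 ≤ n) : g0 (Real.log n + a) = 0 := by
  apply g0_eq_zero
  have h2 : Real.log 2 ≤ Real.log n := Real.log_le_log (by norm_num) (by exact_mod_cast hn)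
  rw [abs_of_nonneg (by linarith [quarter_lt_log_two])]
  linarith [quarter_lt_log_two]

/-- **`𝒜(a, t)` is the Dirichlet polynomial with coefficients `c_a`** for `a ≥ 0`:
`𝒜(a, t) = Σ_{n ≤ N_a} c_a(n) n^{−it}`. [cite: RudnickSarnak1996, (3.14)–(3.15)] -/
theorem primePoly_eq_dirPoly {a : ℝ} (ha : 0 ≤ a) (t : ℝ) :
    primePoly a t = dirPoly (suppBound a) ↗(coefAF a) t := by
  unfold primePoly dirPoly
  have hterm : ∀ n : ℕ, ((Λ n : ℝ) : ℂ) / (Real.sqrt n : ℂ) *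
      (g0 (Real.log n - a) * cexp (((-(t * Real.log n) : ℝ) : ℂ) * I) +
        g0 (Real.log n + a) * cexp (((t * Real.log n : ℝ) : ℂ) * I)) =
      if n = 0 then 0 else ((coefR a n : ℝ) : ℂ) * (n : ℂ) ^ (-((t : ℂ) * I)) := by
    intro n
    rcases Nat.lt_or_ge n 2 with hn | hn
    · interval_cases n <;> simp [vonMangoldt_apply_one]
    · have hn0 : n ≠ 0 := by omega
      rw [if_neg hn0, g0_log_add_eq_zero ha hn, zero_mul, add_zero, ofReal_coefR,
        natCast_cpow_neg_mul_I' hn0, mul_assoc]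
  simp_rw [hterm]
  rw [tsum_eq_sum (s := Finset.Icc 1 (suppBound a))]
  · refine Finset.sum_congr rfl fun n hn ↦ ?_
    rw [if_neg (by have := (Finset.mem_Icc.1 hn).1; omega)]
    rfl
  · intro n hn
    rw [Finset.mem_Icc, not_and_or, not_le, not_le] at hn
    rcases hn with hn | hn
    · simp [show n = 0 by omega]
    · rw [coefR_eq_zero_of_suppBound_lt hn]; simp

/-- For `a ≤ 0`, `𝒜(a, t)` is the conjugate Dirichlet polynomial with coefficients `c_{−a}`:
`𝒜(a, t) = conj (Σ_{n ≤ N_{−a}} c_{−a}(n) n^{−it})`. [cite: RudnickSarnak1996, (3.14)–(3.15)] -/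
theorem primePoly_eq_conj_dirPoly {a : ℝ} (ha : a ≤ 0) (t : ℝ) :
    primePoly a t = conj (dirPoly (suppBound (-a)) ↗(coefAF (-a)) t) := by
  rw [conj_dirPoly]
  unfold primePoly
  have hterm : ∀ n : ℕ, ((Λ n : ℝ) : ℂ) / (Real.sqrt n : ℂ) *
      (g0 (Real.log n - a) * cexp (((-(t * Real.log n) : ℝ) : ℂ) * I) +
        g0 (Real.log n + a) * cexp (((t * Real.log n : ℝ) : ℂ) * I)) =
      if n = 0 then 0 else conj (((coefR (-a) n : ℝ) : ℂ)) * (n : ℂ) ^ ((t : ℂ) * I) := by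
    intro n
    rcases Nat.lt_or_ge n 2 with hn | hn
    · interval_cases n <;> simp [vonMangoldt_apply_one]
    · have hn0 : n ≠ 0 := by omega
      have h1 : g0 (Real.log n - a) = 0 := by
        rw [show Real.log n - a = Real.log n + (-a) by ring]; exact g0_log_add_eq_zero (by linarith) hn
      rw [if_neg hn0, h1, zero_mul, zero_add, Complex.conj_ofReal, ofReal_coefR,
        natCast_cpow_mul_I_eq_cexp hn0, sub_neg_eq_add, mul_assoc]
      congr 2
      push_cast
      ring_nf
  simp_rw [hterm]
  rw [tsum_eq_sum (s := Finset.Icc 1 (suppBound (-a)))]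
  · refine Finset.sum_congr rfl fun n hn ↦ ?_
    rw [if_neg (by have := (Finset.mem_Icc.1 hn).1; omega)]
    rfl
  · intro n hn
    rw [Finset.mem_Icc, not_and_or, not_le, not_le] at hn
    rcases hn with hn | hn
    · simp [show n = 0 by omega]
    · rw [coefR_eq_zero_of_suppBound_lt hn]; simp

/-! ## The `ℓ¹` bound (Chebyshev) -/

/-- `Σ_{n ≤ N} Λ(n) ≤ (log 4 + 4) N` (`Chebyshev.psi_le_const_mul_self`). [folklore] -/
theorem sum_Icc_vonMangoldt_le' (N : ℕ) : ∑ n ∈ Finset.Icc 0 N, Λ n ≤ (Real.log 4 + 4) * N := by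
  have h := Chebyshev.psi_le_const_mul_self (Nat.cast_nonneg N)
  rwa [Chebyshev.psi_eq_sum_Icc, Nat.floor_natCast] at h

/-- The constant of the `ℓ¹` bound: `C₁ = ∫φ · e^{3/8} (log 4 + 4)`. [folklore] -/
def coefL1Const : ℝ :=
  bumpMass * Real.exp (3 / 8) * (Real.log 4 + 4)

/-- `C₁ > 0`. [folklore] -/
theorem coefL1Const_pos : 0 < coefL1Const := by
  unfold coefL1Const
  have := bumpMass_pos
  have : 0 < Real.log 4 + 4 := by have := Real.log_nonneg (by norm_num : (1:ℝ) ≤ 4); linarith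
  positivity

/-- Pointwise: `c_a(n) ≤ ∫φ · e^{1/8 − a/2} Λ(n)` (on the support `√n > e^{(a−1/4)/2}`). [folklore] -/
theorem coefR_le_exp_mul (a : ℝ) (n : ℕ) : coefR a n ≤ bumpMass * Real.exp (1 / 8 - a / 2) * Λ n := by
  by_cases h : coefR a n = 0
  · rw [h]; have := bumpMass_pos; exact mul_nonneg (by positivity) vonMangoldt_nonneg
  · have hlow := exp_lt_of_coefR_ne_zero h
    have hn : (0 : ℝ) < n := (Real.exp_pos _).trans hlow
    refine (coefR_le a n).trans ?_
    rw [mul_assoc]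
    refine mul_le_mul_of_nonneg_left ?_ bumpMass_pos.le
    rw [div_eq_mul_inv, mul_comm]
    refine mul_le_mul_of_nonneg_right ?_ vonMangoldt_nonneg
    -- `1/√n ≤ e^{1/8 − a/2}` since `e^{a − 1/4} < n`
    have hsq : Real.exp (a / 2 - 1 / 8) ≤ Real.sqrt n := by
      rw [show a / 2 - 1 / 8 = (a - 1 / 4) / 2 by ring, Real.exp_half]
      exact Real.sqrt_le_sqrt hlow.le
    rw [inv_le_iff_one_le_mul₀ (Real.sqrt_pos.2 hn)]
    calc (1 : ℝ) = Real.exp (a / 2 - 1 / 8) * Real.exp (1 / 8 - a / 2) := by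
          rw [← Real.exp_add]; norm_num
      _ ≤ Real.sqrt n * Real.exp (1 / 8 - a / 2) := mul_le_mul_of_nonneg_right hsq (Real.exp_pos _).le
      _ = Real.exp (1 / 8 - a / 2) * Real.sqrt n := mul_comm _ _

/-- **`ℓ¹` bound for the coefficients of one slot**: `Σ_{n ∈ s} c_a(n) ≤ C₁ e^{a/2}` for every
finite set `s` (Chebyshev's bound on `[e^{a−1/4}, e^{a+1/4}]`; Rudnick–Sarnak 1996 use (2.7)).
[cite: RudnickSarnak1996, (2.7)] -/
theorem sum_coefR_le (a : ℝ) (s : Finset ℕ) : ∑ n ∈ s, coefR a n ≤ coefL1Const * Real.exp (a / 2) := by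
  classical
  have hsplit : ∑ n ∈ s, coefR a n = ∑ n ∈ s.filter (· ≤ suppBound a), coefR a n := by
    rw [Finset.sum_filter]
    refine Finset.sum_congr rfl fun n _ ↦ ?_
    by_cases h : n ≤ suppBound a
    · rw [if_pos h]
    · rw [if_neg h, coefR_eq_zero_of_suppBound_lt (not_le.1 h)]
  rw [hsplit]
  calc ∑ n ∈ s.filter (· ≤ suppBound a), coefR a n
      ≤ ∑ n ∈ s.filter (· ≤ suppBound a), bumpMass * Real.exp (1 / 8 - a / 2) * Λ n :=
        Finset.sum_le_sum fun n _ ↦ coefR_le_exp_mul a n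
    _ = bumpMass * Real.exp (1 / 8 - a / 2) * ∑ n ∈ s.filter (· ≤ suppBound a), Λ n := by rw [Finset.mul_sum]
    _ ≤ bumpMass * Real.exp (1 / 8 - a / 2) * ∑ n ∈ Finset.Icc 0 (suppBound a), Λ n := by
        have := bumpMass_pos
        refine mul_le_mul_of_nonneg_left ?_ (by positivity)
        refine Finset.sum_le_sum_of_subset_of_nonneg (fun n hn ↦ ?_) fun n _ _ ↦ vonMangoldt_nonneg
        rw [Finset.mem_filter] at hn
        rw [Finset.mem_Icc]; exact ⟨Nat.zero_le _, hn.2⟩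
    _ ≤ bumpMass * Real.exp (1 / 8 - a / 2) * ((Real.log 4 + 4) * suppBound a) := by
        have := bumpMass_pos
        exact mul_le_mul_of_nonneg_left (sum_Icc_vonMangoldt_le' _) (by positivity)
    _ ≤ bumpMass * Real.exp (1 / 8 - a / 2) * ((Real.log 4 + 4) * Real.exp (a + 1 / 4)) := by
        have := bumpMass_pos
        have : 0 < Real.log 4 + 4 := by have := Real.log_nonneg (by norm_num : (1:ℝ) ≤ 4); linarith
        gcongr
        exact suppBound_le a
    _ = coefL1Const * Real.exp (a / 2) := by
        unfold coefL1Const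
        have e : Real.exp (1 / 8 - a / 2) * Real.exp (a + 1 / 4) = Real.exp (3 / 8) * Real.exp (a / 2) := by
          rw [← Real.exp_add, ← Real.exp_add]; congr 1; ring
        calc bumpMass * Real.exp (1 / 8 - a / 2) * ((Real.log 4 + 4) * Real.exp (a + 1 / 4))
            = bumpMass * (Real.log 4 + 4) * (Real.exp (1 / 8 - a / 2) * Real.exp (a + 1 / 4)) := by ring
          _ = _ := by rw [e]; ring

/-! ## `a_r ≤ log^r`: powers of `Λ` in the Dirichlet ring -/

/-- Auxiliary: `log a ≤ log b` for naturals `a ≤ b`. [folklore] -/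
theorem _root_.Real.log_le_log_of_le' (a : ℕ) {b : ℕ} (h : a ≤ b) : Real.log a ≤ Real.log b := by
  rcases Nat.eq_zero_or_pos a with rfl | ha
  · simp [Real.log_natCast_nonneg]
  · exact Real.log_le_log (by exact_mod_cast ha) (by exact_mod_cast h)



/-- `Λ^{*r} ≥ 0`. [folklore] -/
theorem vonMangoldt_pow_nonneg (r n : ℕ) : 0 ≤ ((Λ : ArithmeticFunction ℝ) ^ r) n := by
  induction r generalizing n with
  | zero =>
    rw [pow_zero, one_apply]
    split_ifs <;> norm_num
  | succ r ih =>
    rw [pow_succ, mul_apply]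
    exact Finset.sum_nonneg fun p _ ↦ mul_nonneg (ih _) vonMangoldt_nonneg

/-- **`a_r(m) ≤ (log m)^r`**: `(Λ^{*r})(m) = Σ_{n_1⋯n_r = m} Π Λ(n_i) ≤ (log m)^r` (induction with
`Σ_{d | m} Λ(d) = log m`; Rudnick–Sarnak 1996, (3.37), define `a_k(m)`). [cite: RudnickSarnak1996, (3.37)] -/
theorem vonMangoldt_pow_le (r m : ℕ) : ((Λ : ArithmeticFunction ℝ) ^ r) m ≤ Real.log m ^ r := by
  induction r generalizing m with
  | zero =>
    rw [pow_zero, one_apply, pow_zero]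
    split_ifs <;> norm_num
  | succ r ih =>
    rw [pow_succ, mul_apply]
    have hlog0 : 0 ≤ Real.log m := Real.log_natCast_nonneg m
    calc ∑ p ∈ m.divisorsAntidiagonal, ((Λ : ArithmeticFunction ℝ) ^ r) p.1 * Λ p.2
        ≤ ∑ p ∈ m.divisorsAntidiagonal, Real.log m ^ r * Λ p.2 := by
          refine Finset.sum_le_sum fun p hp ↦ mul_le_mul_of_nonneg_right ((ih p.1).trans ?_) vonMangoldt_nonneg
          obtain ⟨hpm, hm0⟩ := Nat.mem_divisorsAntidiagonal.1 hp
          have hp1 : p.1 ≤ m := Nat.le_of_dvd (Nat.pos_of_ne_zero hm0) ⟨p.2, hpm.symm⟩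
          exact pow_le_pow_left₀ (Real.log_natCast_nonneg _) (Real.log_le_log_of_le' p.1 hp1) r
      _ = Real.log m ^ r * ∑ p ∈ m.divisorsAntidiagonal, Λ p.2 := by rw [Finset.mul_sum]
      _ = Real.log m ^ r * Real.log m := by
          congr 1
          rw [Nat.sum_divisorsAntidiagonal' (f := fun _ j ↦ (Λ j : ℝ)), vonMangoldt_sum]
      _ = Real.log m ^ (r + 1) := by ring

/-! ## Products over slots -/

variable {ι : Type*}

/-- The coefficient function of a product of slots: the Dirichlet product `Π_{j ∈ S} c_{a_j}`
(`(coefProd S a)(m) = Σ_{Π n_j = m} Π_j c_{a_j}(n_j)`; Rudnick–Sarnak 1996, (3.33)).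
[cite: RudnickSarnak1996, (3.33)] -/
def coefProd (S : Finset ι) (a : ι → ℝ) : ArithmeticFunction ℝ :=
  ∏ j ∈ S, coefAF (a j)

/-- `coefProd ∅ a = 1` (the Dirichlet unit). [folklore] -/
@[simp] theorem coefProd_empty (a : ι → ℝ) : coefProd (∅ : Finset ι) a = 1 := by
  simp [coefProd]

/-- `coefProd (insert i S) a = coefAF (a i) * coefProd S a`. [folklore] -/
theorem coefProd_insert [DecidableEq ι] {S : Finset ι} {i : ι} (hi : i ∉ S) (a : ι → ℝ) :
    coefProd (insert i S) a = coefAF (a i) * coefProd S a := by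
  simp [coefProd, Finset.prod_insert hi]

/-- `coefProd ≥ 0`. [folklore] -/
theorem coefProd_nonneg [DecidableEq ι] (S : Finset ι) (a : ι → ℝ) (m : ℕ) : 0 ≤ coefProd S a m := by
  induction S using Finset.induction_on generalizing m with
  | empty => rw [coefProd_empty, one_apply]; split_ifs <;> norm_num
  | insert i S hi ih =>
    rw [coefProd_insert hi, mul_apply]
    exact Finset.sum_nonneg fun p _ ↦ mul_nonneg (coefR_nonneg _ _) (ih _)

/-- **Pointwise bound**: `(coefProd S a)(m) ≤ (∫φ)^{|S|} (Λ^{*|S|})(m)/√m`. [cite: RudnickSarnak1996, (3.37)] -/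
theorem coefProd_le [DecidableEq ι] (S : Finset ι) (a : ι → ℝ) (m : ℕ) :
    coefProd S a m ≤ bumpMass ^ S.card * ((Λ : ArithmeticFunction ℝ) ^ S.card) m / Real.sqrt m := by
  induction S using Finset.induction_on generalizing m with
  | empty =>
    rw [coefProd_empty, Finset.card_empty, pow_zero, pow_zero, one_apply, one_mul]
    split_ifs with h
    · subst h; simp
    · simp
  | insert i S hi ih =>
    rw [coefProd_insert hi, mul_apply, Finset.card_insert_of_notMem hi, pow_succ, pow_succ', mul_apply,
      Finset.mul_sum, Finset.sum_div]
    refine Finset.sum_le_sum fun p hp ↦ ?_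
    obtain ⟨hpm, hm0⟩ := Nat.mem_divisorsAntidiagonal.1 hp
    have hp1 : p.1 ≠ 0 := by rintro h; rw [h, zero_mul] at hpm; exact hm0 hpm.symm
    have hp2 : p.2 ≠ 0 := by rintro h; rw [h, mul_zero] at hpm; exact hm0 hpm.symm
    have hsqrt : Real.sqrt m = Real.sqrt p.1 * Real.sqrt p.2 := by
      rw [← hpm, Nat.cast_mul, Real.sqrt_mul (Nat.cast_nonneg _)]
    have h1 := coefR_le (a i) p.1
    have h2 := ih p.2
    rw [coefAF_apply]
    have hs1 : 0 < Real.sqrt p.1 := Real.sqrt_pos.2 (by exact_mod_cast Nat.pos_of_ne_zero hp1)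
    have hs2 : 0 < Real.sqrt p.2 := Real.sqrt_pos.2 (by exact_mod_cast Nat.pos_of_ne_zero hp2)
    calc coefR (a i) p.1 * coefProd S a p.2
        ≤ (bumpMass * (Λ p.1 / Real.sqrt p.1)) * (bumpMass ^ S.card * ((Λ : ArithmeticFunction ℝ) ^ S.card) p.2 / Real.sqrt p.2) :=
          mul_le_mul h1 h2 (coefProd_nonneg S a _) (by have := bumpMass_pos; positivity)
      _ = bumpMass ^ S.card * bumpMass * (Λ p.1 * ((Λ : ArithmeticFunction ℝ) ^ S.card) p.2) / Real.sqrt m := by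
          rw [hsqrt]; field_simp

/-- Auxiliary reindexing of the Dirichlet product for the swapped order `Λ^{*r} * Λ` vs `Λ * Λ^{*r}`:
the value `(Λ^{*(r+1)})(m)` as `Σ_{(d,e)} (Λ^{*r})(d) Λ(e)` equals `Σ_{(d,e)} Λ(d) (Λ^{*r})(e)`. [folklore] -/
theorem vonMangoldt_pow_succ_apply (r m : ℕ) :
    ((Λ : ArithmeticFunction ℝ) ^ r * Λ) m = ∑ p ∈ m.divisorsAntidiagonal, Λ p.1 * ((Λ : ArithmeticFunction ℝ) ^ r) p.2 := by
  rw [← pow_succ, pow_succ', mul_apply]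

/-- Support, upper end: `(coefProd S a)(m) = 0` for `m > Π_j N_{a_j}`. [folklore] -/
theorem coefProd_eq_zero_of_lt [DecidableEq ι] (S : Finset ι) (a : ι → ℝ) {m : ℕ}
    (h : (∏ j ∈ S, suppBound (a j)) < m) : coefProd S a m = 0 := by
  induction S using Finset.induction_on generalizing m with
  | empty =>
    rw [Finset.prod_empty] at h
    rw [coefProd_empty, one_apply, if_neg (by omega)]
  | insert i S hi ih =>
    rw [coefProd_insert hi, mul_apply]
    refine Finset.sum_eq_zero fun p hp ↦ ?_
    obtain ⟨hpm, hm0⟩ := Nat.mem_divisorsAntidiagonal.1 hp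
    rw [Finset.prod_insert hi] at h
    by_cases h1 : suppBound (a i) < p.1
    · rw [coefAF_apply, coefR_eq_zero_of_suppBound_lt h1, zero_mul]
    · by_cases h2 : (∏ j ∈ S, suppBound (a j)) < p.2
      · rw [ih h2, mul_zero]
      · exfalso
        push Not at h1 h2
        have := Nat.mul_le_mul h1 h2
        rw [hpm] at this
        omega

/-- `exp` of a difference is monotone helper: if `e^{α} < d` and `e^{β} < e` then `e^{α+β} < d e`.
[folklore] -/
theorem exp_add_lt_mul {α β : ℝ} {d e : ℝ} (hd : Real.exp α < d) (he : Real.exp β < e) :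
    Real.exp (α + β) < d * e := by
  rw [Real.exp_add]
  exact mul_lt_mul'' hd he (Real.exp_pos _).le (Real.exp_pos _).le

/-- Support, lower end: if `(coefProd S a)(m) ≠ 0` and `S` is nonempty then
`e^{Σ_j a_j − |S|/4} < m`. [folklore] -/
theorem exp_lt_of_coefProd_ne_zero [DecidableEq ι] {S : Finset ι} (hS : S.Nonempty) (a : ι → ℝ) {m : ℕ}
    (h : coefProd S a m ≠ 0) : Real.exp (∑ j ∈ S, a j - S.card / 4) < m := by
  induction S using Finset.induction_on generalizing m with
  | empty => exact absurd hS Finset.not_nonempty_empty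
  | insert i S hi ih =>
    rw [coefProd_insert hi, mul_apply] at h
    obtain ⟨p, hp, hne⟩ := Finset.exists_ne_zero_of_sum_ne_zero h
    obtain ⟨hpm, hm0⟩ := Nat.mem_divisorsAntidiagonal.1 hp
    have h1 : coefR (a i) p.1 ≠ 0 := by intro h0; rw [coefAF_apply, h0, zero_mul] at hne; exact hne rfl
    have h2 : coefProd S a p.2 ≠ 0 := by intro h0; rw [h0, mul_zero] at hne; exact hne rfl
    have hd := exp_lt_of_coefR_ne_zero h1
    rw [Finset.sum_insert hi, Finset.card_insert_of_notMem hi]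
    rcases S.eq_empty_or_nonempty with hS' | hS'
    · subst hS'
      simp only [Finset.sum_empty, add_zero, Finset.card_empty, zero_add, Nat.cast_one]
      have hp2 : p.2 = 1 := by
        rw [coefProd_empty, one_apply] at h2
        by_contra hne1; exact h2 (if_neg hne1)
      rw [hp2, mul_one] at hpm
      rw [← hpm]
      convert hd using 2
    · have he := ih hS' h2
      have := exp_add_lt_mul hd he
      rw [← hpm, Nat.cast_mul]
      convert this using 2
      push_cast
      ring

/-! ## The `ℓ¹` bound for products -/

/-- Double sums over `divisorsAntidiagonal` are dominated by product sums (non-negative terms):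
`Σ_{m ≤ B} Σ_{de = m} f(d) g(e) ≤ (Σ_{d ≤ B} f(d)) (Σ_{e ≤ B} g(e))`. [folklore] -/
theorem sum_sum_antidiagonal_le {f g : ℕ → ℝ} (hf : ∀ n, 0 ≤ f n) (hg : ∀ n, 0 ≤ g n) (B : ℕ) :
    ∑ m ∈ Finset.range (B + 1), ∑ p ∈ m.divisorsAntidiagonal, f p.1 * g p.2 ≤
      (∑ d ∈ Finset.range (B + 1), f d) * ∑ e ∈ Finset.range (B + 1), g e := by
  classical
  rw [Finset.sum_mul_sum, ← Finset.sum_product', Finset.sum_sigma']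
  -- inject the sigma-type index set into the product
  set σs : Finset (Σ _ : ℕ, ℕ × ℕ) := (Finset.range (B + 1)).sigma fun m ↦ m.divisorsAntidiagonal
  have hinj : Set.InjOn (fun x : (Σ _ : ℕ, ℕ × ℕ) ↦ x.2) σs := by
    rintro ⟨m, p⟩ hx ⟨m', p'⟩ hx' hpp
    simp only [σs, Finset.mem_coe, Finset.mem_sigma] at hx hx'
    simp only at hpp
    subst hpp
    have h1 := (Nat.mem_divisorsAntidiagonal.1 hx.2).1
    have h2 := (Nat.mem_divisorsAntidiagonal.1 hx'.2).1
    rw [h1] at h2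
    subst h2
    rfl
  calc ∑ x ∈ σs, f x.2.1 * g x.2.2
      = ∑ p ∈ σs.image (fun x ↦ x.2), f p.1 * g p.2 := by
        rw [Finset.sum_image hinj]
    _ ≤ ∑ p ∈ Finset.range (B + 1) ×ˢ Finset.range (B + 1), f p.1 * g p.2 := by
        refine Finset.sum_le_sum_of_subset_of_nonneg (fun p hp ↦ ?_) fun p _ _ ↦ mul_nonneg (hf _) (hg _)
        rw [Finset.mem_image] at hp
        obtain ⟨⟨m, q⟩, hx, rfl⟩ := hp
        simp only [σs, Finset.mem_sigma, Finset.mem_range] at hx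
        obtain ⟨hm, hq⟩ := hx
        obtain ⟨hqm, hm0⟩ := Nat.mem_divisorsAntidiagonal.1 hq
        have hq1 : q.1 ≤ m := Nat.le_of_dvd (Nat.pos_of_ne_zero hm0) ⟨q.2, hqm.symm⟩
        have hq2 : q.2 ≤ m := Nat.le_of_dvd (Nat.pos_of_ne_zero hm0) ⟨q.1, by rw [mul_comm]; exact hqm.symm⟩
        simp only [Finset.mem_product, Finset.mem_range]
        omega

/-- **`ℓ¹` bound for products**: `Σ_{m ∈ s} (coefProd S a)(m) ≤ Π_{j ∈ S} C₁ e^{a_j/2}`.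
[cite: RudnickSarnak1996, (2.7)] -/
theorem sum_coefProd_le [DecidableEq ι] (S : Finset ι) (a : ι → ℝ) (s : Finset ℕ) :
    ∑ m ∈ s, coefProd S a m ≤ ∏ j ∈ S, (coefL1Const * Real.exp (a j / 2)) := by
  induction S using Finset.induction_on generalizing s with
  | empty =>
    rw [Finset.prod_empty, coefProd_empty]
    simp only [one_apply]
    rw [Finset.sum_ite_eq']
    split_ifs <;> norm_num
  | insert i S hi ih =>
    rw [Finset.prod_insert hi, coefProd_insert hi]
    -- enlarge `s` to a range
    set B : ℕ := s.sup id
    have hsub : s ⊆ Finset.range (B + 1) := fun m hm ↦ Finset.mem_range.2 (Nat.lt_succ_of_le (Finset.le_sup (f := id) hm))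
    calc ∑ m ∈ s, (coefAF (a i) * coefProd S a) m
        ≤ ∑ m ∈ Finset.range (B + 1), (coefAF (a i) * coefProd S a) m :=
          Finset.sum_le_sum_of_subset_of_nonneg hsub fun m _ _ ↦ by
            rw [← coefProd_insert hi]; exact coefProd_nonneg _ _ _
      _ = ∑ m ∈ Finset.range (B + 1), ∑ p ∈ m.divisorsAntidiagonal, coefR (a i) p.1 * coefProd S a p.2 := by
          simp only [mul_apply, coefAF_apply]
      _ ≤ (∑ d ∈ Finset.range (B + 1), coefR (a i) d) * ∑ e ∈ Finset.range (B + 1), coefProd S a e :=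
          sum_sum_antidiagonal_le (coefR_nonneg _) (coefProd_nonneg S a) B
      _ ≤ (coefL1Const * Real.exp (a i / 2)) * ∏ j ∈ S, (coefL1Const * Real.exp (a j / 2)) :=
          mul_le_mul (sum_coefR_le _ _) (ih _) (Finset.sum_nonneg fun e _ ↦ coefProd_nonneg S a e)
            (by have := coefL1Const_pos; positivity)

/-! ## Square sums -/

/-- **Square sums of the product coefficients**: for nonempty `S` and every `N`,
`Σ_{m ≤ N} (coefProd S a)(m)² ≤ (∫φ · C₁ · e^{1/8} · log N)^{|S|}`
(sup × `ℓ¹`: the factors `e^{∓Σ a_j/2}` cancel). [cite: RudnickSarnak1996, Lemma 3.5] -/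
theorem sum_sq_coefProd_le [DecidableEq ι] {S : Finset ι} (hS : S.Nonempty) (a : ι → ℝ) (N : ℕ) :
    ∑ m ∈ Finset.Icc 1 N, coefProd S a m ^ 2 ≤
      (bumpMass * coefL1Const * Real.exp (1 / 8) * Real.log N) ^ S.card := by
  set r := S.card
  have hr : 1 ≤ r := Finset.card_pos.2 hS
  -- the sup bound on `[1, N]`
  have hsup : ∀ m ∈ Finset.Icc 1 N, coefProd S a m ≤
      bumpMass ^ r * Real.exp (1 / 8) ^ r * Real.log N ^ r * Real.exp (-(∑ j ∈ S, a j) / 2) := by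
    intro m hm
    obtain ⟨hm1, hmN⟩ := Finset.mem_Icc.1 hm
    by_cases h0 : coefProd S a m = 0
    · rw [h0]; have := bumpMass_pos; positivity
    have hlow := exp_lt_of_coefProd_ne_zero hS a h0
    have hmpos : (0 : ℝ) < m := by exact_mod_cast hm1
    refine (coefProd_le S a m).trans ?_
    have hΛ : ((Λ : ArithmeticFunction ℝ) ^ r) m ≤ Real.log N ^ r :=
      (vonMangoldt_pow_le r m).trans (pow_le_pow_left₀ (Real.log_natCast_nonneg _) (Real.log_le_log_of_le' m hmN) r)
    -- `1/√m ≤ e^{r/8} e^{-Σ a/2}`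
    have hsq : 1 / Real.sqrt m ≤ Real.exp (1 / 8) ^ r * Real.exp (-(∑ j ∈ S, a j) / 2) := by
      rw [← Real.exp_nat_mul, ← Real.exp_add, div_le_iff₀ (Real.sqrt_pos.2 hmpos)]
      have : Real.exp ((∑ j ∈ S, a j - r / 4) / 2) ≤ Real.sqrt m := by
        rw [Real.exp_half]; exact Real.sqrt_le_sqrt hlow.le
      calc (1 : ℝ) = Real.exp (r * (1 / 8) + -(∑ j ∈ S, a j) / 2) * Real.exp ((∑ j ∈ S, a j - r / 4) / 2) := by
            rw [← Real.exp_add]; convert Real.exp_zero.symm using 2; ring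
        _ ≤ _ := mul_le_mul_of_nonneg_left this (Real.exp_pos _).le
    calc bumpMass ^ r * ((Λ : ArithmeticFunction ℝ) ^ r) m / Real.sqrt m
        = bumpMass ^ r * ((Λ : ArithmeticFunction ℝ) ^ r) m * (1 / Real.sqrt m) := by ring
      _ ≤ bumpMass ^ r * Real.log N ^ r * (Real.exp (1 / 8) ^ r * Real.exp (-(∑ j ∈ S, a j) / 2)) := by
          have := bumpMass_pos
          exact mul_le_mul (mul_le_mul_of_nonneg_left hΛ (by positivity)) hsq (by positivity) (by positivity)
      _ = _ := by ring
  have hl1 := sum_coefProd_le S a (Finset.Icc 1 N)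
  have hprod : ∏ j ∈ S, (coefL1Const * Real.exp (a j / 2)) = coefL1Const ^ r * Real.exp ((∑ j ∈ S, a j) / 2) := by
    rw [Finset.prod_mul_distrib, Finset.prod_const, ← Real.exp_sum, Finset.sum_div]
  rw [hprod] at hl1
  set K := bumpMass ^ r * Real.exp (1 / 8) ^ r * Real.log N ^ r * Real.exp (-(∑ j ∈ S, a j) / 2)
  have hK : 0 ≤ K := by have := bumpMass_pos; positivity
  calc ∑ m ∈ Finset.Icc 1 N, coefProd S a m ^ 2
      ≤ ∑ m ∈ Finset.Icc 1 N, K * coefProd S a m := by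
        refine Finset.sum_le_sum fun m hm ↦ ?_
        rw [sq]
        exact mul_le_mul_of_nonneg_right (hsup m hm) (coefProd_nonneg S a m)
    _ = K * ∑ m ∈ Finset.Icc 1 N, coefProd S a m := by rw [Finset.mul_sum]
    _ ≤ K * (coefL1Const ^ r * Real.exp ((∑ j ∈ S, a j) / 2)) := mul_le_mul_of_nonneg_left hl1 hK
    _ = (bumpMass * coefL1Const * Real.exp (1 / 8) * Real.log N) ^ r := by
        simp only [K]
        rw [mul_pow, mul_pow, mul_pow]
        have : Real.exp (-(∑ j ∈ S, a j) / 2) * Real.exp ((∑ j ∈ S, a j) / 2) = 1 := by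
          rw [← Real.exp_add]; convert Real.exp_zero using 2; ring
        calc bumpMass ^ r * Real.exp (1 / 8) ^ r * Real.log N ^ r * Real.exp (-(∑ j ∈ S, a j) / 2) *
              (coefL1Const ^ r * Real.exp ((∑ j ∈ S, a j) / 2))
            = bumpMass ^ r * coefL1Const ^ r * Real.exp (1 / 8) ^ r * Real.log N ^ r *
                (Real.exp (-(∑ j ∈ S, a j) / 2) * Real.exp ((∑ j ∈ S, a j) / 2)) := by ring
          _ = _ := by rw [this, mul_one]

/-- **Weighted square sums**: `Σ_{m ≤ N} m (coefProd S a)(m)² ≤ N (∫φ · C₁ · e^{1/8} · log N)^{|S|}`.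
[cite: RudnickSarnak1996, Lemma 3.5] -/
theorem sum_mul_sq_coefProd_le [DecidableEq ι] {S : Finset ι} (hS : S.Nonempty) (a : ι → ℝ) (N : ℕ) :
    ∑ m ∈ Finset.Icc 1 N, (m : ℝ) * coefProd S a m ^ 2 ≤
      N * (bumpMass * coefL1Const * Real.exp (1 / 8) * Real.log N) ^ S.card := by
  calc ∑ m ∈ Finset.Icc 1 N, (m : ℝ) * coefProd S a m ^ 2
      ≤ ∑ m ∈ Finset.Icc 1 N, (N : ℝ) * coefProd S a m ^ 2 := by
        refine Finset.sum_le_sum fun m hm ↦ mul_le_mul_of_nonneg_right ?_ (sq_nonneg _)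
        exact_mod_cast (Finset.mem_Icc.1 hm).2
    _ = N * ∑ m ∈ Finset.Icc 1 N, coefProd S a m ^ 2 := by rw [Finset.mul_sum]
    _ ≤ _ := mul_le_mul_of_nonneg_left (sum_sq_coefProd_le hS a N) (Nat.cast_nonneg N)

/-! ## Multiplicativity of the Dirichlet polynomials -/

/-- A finitely supported arithmetic function has an everywhere convergent `L`-series. [folklore] -/
theorem LSeriesSummable_of_eq_zero {f : ArithmeticFunction ℝ} {N : ℕ} (hf : ∀ n, N < n → f n = 0) (s : ℂ) :
    LSeriesSummable ↗f s := by
  refine summable_of_ne_finset_zero (s := Finset.range (N + 1)) fun n hn ↦ ?_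
  rw [Finset.mem_range, not_lt] at hn
  rw [LSeries.term_def]
  split_ifs with h
  · rfl
  · rw [hf n (by omega)]; simp

/-- The `L`-series of a finitely supported arithmetic function at `s = it` is its Dirichlet
polynomial: `L(f, it) = Σ_{n ≤ N} f(n) n^{−it}`. [folklore] -/
theorem LSeries_eq_dirPoly {f : ArithmeticFunction ℝ} {N : ℕ} (hf : ∀ n, N < n → f n = 0) (t : ℝ) :
    LSeries ↗f ((t : ℂ) * I) = dirPoly N ↗f t := by
  rw [LSeries, dirPoly, tsum_eq_sum (s := Finset.Icc 1 N)]
  · refine Finset.sum_congr rfl fun n hn ↦ ?_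
    have hn0 : n ≠ 0 := by have := (Finset.mem_Icc.1 hn).1; omega
    rw [LSeries.term_of_ne_zero hn0, div_eq_mul_inv, ← Complex.cpow_neg]
  · intro n hn
    rw [Finset.mem_Icc, not_and_or, not_le, not_le] at hn
    rw [LSeries.term_def]
    split_ifs with h
    · rfl
    · rcases hn with hn | hn
      · omega
      · rw [hf n hn]; simp

/-- The real cast commutes with the Dirichlet product: `↗(f * g) = ↗f ⍟ ↗g`. [folklore] -/
theorem cast_mul_eq_convolution (f g : ArithmeticFunction ℝ) : ↗(f * g) = ↗f ⍟ ↗g := by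
  rw [LSeries.convolution_def]
  funext n
  rw [mul_apply]
  push_cast
  rfl

/-- **Multiplicativity**: the Dirichlet polynomial of `coefProd S a` is the product of the
Dirichlet polynomials of the slots,
`Σ_m (coefProd S a)(m) m^{−it} = Π_{j ∈ S} Σ_n c_{a_j}(n) n^{−it}` (`LSeries_convolution'`).
[cite: RudnickSarnak1996, (3.33)] -/
theorem dirPoly_coefProd [DecidableEq ι] (S : Finset ι) (a : ι → ℝ) (t : ℝ) :
    dirPoly (∏ j ∈ S, suppBound (a j)) ↗(coefProd S a) t = ∏ j ∈ S, dirPoly (suppBound (a j)) ↗(coefAF (a j)) t := by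
  induction S using Finset.induction_on with
  | empty =>
    rw [Finset.prod_empty, Finset.prod_empty, coefProd_empty, dirPoly, show Finset.Icc 1 1 = {1} from rfl,
      Finset.sum_singleton]
    simp [one_apply]
  | insert i S hi ih =>
    rw [Finset.prod_insert hi, Finset.prod_insert hi, ← ih, coefProd_insert hi]
    have hA : ∀ n, suppBound (a i) < n → coefAF (a i) n = 0 := fun n hn ↦ coefR_eq_zero_of_suppBound_lt hn
    have hB : ∀ n, (∏ j ∈ S, suppBound (a j)) < n → coefProd S a n = 0 := fun n hn ↦ coefProd_eq_zero_of_lt S a hn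
    have hAB : ∀ n, suppBound (a i) * (∏ j ∈ S, suppBound (a j)) < n → (coefAF (a i) * coefProd S a) n = 0 := by
      intro n hn
      rw [← coefProd_insert hi]
      refine coefProd_eq_zero_of_lt _ a ?_
      rwa [Finset.prod_insert hi]
    rw [← LSeries_eq_dirPoly hAB, ← LSeries_eq_dirPoly hA, ← LSeries_eq_dirPoly hB, cast_mul_eq_convolution,
      LSeries_convolution' (LSeriesSummable_of_eq_zero hA _) (LSeriesSummable_of_eq_zero hB _)]

end RudnickSarnakN

end Literature.NumberTheory.LFunctions

end
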